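import Mathlib
import Summits.Ventures.HodgeRepro.Tier4.Line4.HorbChain
import Summits.Ventures.HodgeRepro.Tier4.Line4.ProperDefs
import Summits.Ventures.HodgeRepro.Tier4.Line4.IntegFolded
import Summits.Ventures.HodgeRepro.Tier4.Line4.IntegArch
import Summits.Ventures.HodgeRepro.Tier4.Line4.IntegProper

/-!
# Tier4/Line4/HorbInteg — C-L4-HORBINTEG: `horb` from the chain with every integrability display discharged

Blind re-derivation cell `pub-hodge-repro`, Tier 4 «prove the step» (README §9–§10), seat t4-L2-p1 (gen 3; L4 service
prover).  Tree path `lean/Summits/Ventures/HodgeRepro/Tier4/Line4/HorbInteg.lean`.  Statement and proof = Part 9 of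
plan-4 g3's certificate proofs/t4-plan-4/work/Integ-Concat-v2.lean efc313b641e3a2f3 · 671 (S14649 / S14670, crit-1
S14664 / S14699), BYTES VERBATIM, every stub of the certificate now an imported tree theorem: `horb_of_chain` (HorbChain
p698645), the thirteen C-L4-INTEG statements (IntegFolded p697292 + IntegArch p697545, t4-L1-p5; IntegProper p698134) and
`HasProperFinOrbit` (ProperDefs p697453).  Mathlib-level; no literature.

`horb_of_integ`: the wall's `horb` binder from a product test function `F = F_∞ ⊗ F_f` (`F_f` real non-negative,
compactly supported on `G(𝔸_f)`), a regular rational `γ₀` with PROPER (`hprop`), product Haar normalisations on both tori,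
a fundamental domain `DZ_f` of the image of `Z(k)` in `T_f` relatively compact on `Z_f`-saturations of compacts (`hfd`,
`hDZc` = ZDOMAIN-EX), FINPOS′ / FINSUPP (`hpos`, `hsupp`) and the ARCHIMEDEAN RESIDUAL `harch`.  Nothing is asserted
beyond the composition; the price of `horb` is the binder list.

Nothing here says anything about the status of the Hodge conjecture for CM abelian varieties, which is NOT proved
(HC_CM is NOT proved by anyone in this repository).
-/

set_option autoImplicit false
noncomputable section
namespace Summit.Ventures.HodgeRepro.Tier4.Line4
open Summit.Ventures.HodgeRepro.Tier4 Summit.Ventures.HodgeRepro.Tier4.Common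
  Summit.Ventures.HodgeRepro.Tier4.Line1 MeasureTheory
open scoped ComplexConjugate Topology Pointwise NNReal

/-! ## `horb` with the displays discharged (Part 9 of Integ-Concat-v2 efc313b641e3a2f3, by name): PROPER + ZDOMAIN-EX (iv)
+ FINPOS′/FINSUPP + `harch`. -/

section Composition2
variable {k : Type} [Field k] [NumberField k] (W : PlaneData k) [MeasurableSpace (GA W)] [BorelSpace (GA W)]
  (R : RTFData W) (μ : Measure (GA W)) [μ.IsHaarMeasure] [R.μT.IsHaarMeasure] [R.μT'.IsHaarMeasure]
  (DG : Set (GA W)) (fdG : IsFundamentalDomain (rationalPoints W) DG μ) (compG : IsCompact (closure DG))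
  (compT : IsCompact (closure R.DT)) (compT' : IsCompact (closure R.DT'))

/-- **`horb` from the chain with every integrability display discharged by Part 8.**  The price that remains:
`hF` (CONVPROD + PROJPROD), `hprop` (PROPER), `hfd`/`hDZc` (ZDOMAIN-EX under the CM input), `hpos`/`hsupp` (FINPOS′ +
FINSUPP) and the archimedean residual `harch`. -/
theorem horb_of_integ [MeasurableMul (torusT W)] [MeasurableMul (torusT' W)]
    [CompactSpace (torusInf W)] [CompactSpace (torusInf' W)]
    (hR : R.IsHaar) (hc : Continuous R.chi) (hu : ∀ a, ‖R.chi a‖ = 1)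
    (hc' : Continuous R.chi') (hu' : ∀ a, ‖R.chi' a‖ = 1)
    (F Finf Ffin : GA W → ℂ) (hF : ∀ g, F g = Finf (GA.ofInfPart W g) * Ffin (GA.ofFinPart W g))
    (hFc : Continuous F) (hFs : HasCompactSupport F) (hFinfc : Continuous Finf) (hFfinc : Continuous Ffin)
    (Cf : Set (GA W)) (hCf : IsCompact Cf) (hFsupp : ∀ g ∈ finitePart W, Ffin g ≠ 0 → g ∈ Cf)
    (γ₀ : rationalPoints W) (hreg : IsRegularRational W γ₀) (hprop : HasProperFinOrbit W (γ₀ : GA W))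
    (νinf : Measure (torusInf W)) [νinf.IsHaarMeasure] (νf : Measure (torusFin W)) [νf.IsHaarMeasure]
    (c : ℝ≥0) (hcμ : R.μT = c • Measure.map (torusSplit W).symm (νinf.prod νf)) (hc0 : c ≠ 0)
    (νinf' : Measure (torusInf' W)) [νinf'.IsHaarMeasure] (νf' : Measure (torusFin' W)) [νf'.IsHaarMeasure]
    (c' : ℝ≥0) (hcμ' : R.μT' = c' • Measure.map (torusSplit' W).symm (νinf'.prod νf')) (hc0' : c' ≠ 0)
    (DZf : Set (torusFin W)) (hDZf : MeasurableSet DZf) (hfd : IsFundamentalDomain (centreFin W) DZf νf)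
    (hDZc : ∀ C : Set (torusFin W), IsCompact C → IsCompact (closure (DZf ∩ (C * (ZfIn W : Set (torusFin W))))))
    (hreal : ∀ g, (Ffin g).im = 0) (hnonneg : ∀ g, 0 ≤ (Ffin g).re)
    (hpos : ∀ b ∈ DZf, ∀ b' : torusFin' W,
      Ffin ((((b : torusT W) : GA W))⁻¹ * GA.ofFinPart W (γ₀ : GA W) * ((b' : torusT' W) : GA W)) ≠ 0 →
      0 < (R.chi b * conj (R.chi' b')).re)
    (hsupp : 0 < (νf.restrict DZf).prod νf' {p : torusFin W × torusFin' W |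
      Ffin ((((p.1 : torusT W) : GA W))⁻¹ * GA.ofFinPart W (γ₀ : GA W) * ((p.2 : torusT' W) : GA W)) ≠ 0})
    (harch : (∫ a : torusInf W, R.chi a * innerInf W R Finf (γ₀ : GA W) νinf' a ∂νinf) ≠ 0) :
    (Setting.ofAdelicData W R μ DG fdG compG compT compT').orbital R.chi R.chi'
      ((Setting.ofAdelicData W R μ DG fdG compG compT compT').orbitOf γ₀) F ≠ 0 :=
  horb_of_chain W R μ DG fdG compG compT compT' hR F Finf Ffin hF γ₀ hreg νinf νf c hcμ hc0 νinf' νf' c' hcμ' hc0'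
    DZf hDZf hfd
    (fun γ t => integrable_innerFn_restrict W R hR hc' hu' F hFc hFs (γ : GA W) t)
    (fun t => summable_integral_norm_innerFn_orbit W R hR hc' hu' compT' F hFc hFs γ₀ t)
    (fun γ => integrable_chi_mul_innerInt_restrict W R hR hc hu hc' hu' F hFc hFs (γ : GA W))
    (summable_integral_norm_chi_mul_innerInt_orbit W R hR hc hu hc' hu' compT compT' F hFc hFs γ₀)
    (summable_orbitalc_orbit W R hR hc hu hc' hu' compT compT' F hFc hFs γ₀)
    (integrableOn_chi_mul_innerFull_prodDomain W R hR hc hu hc' hu' F hFc hFs γ₀ hprop DZf hDZf hDZc)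
    (fun s => integrable_innerFn_full W R hR hc' hu' F hFc hFs (γ₀ : GA W) s)
    (fun _ _ => integrable_chi_mul_innerInt_restrict W R hR hc hu hc' hu' F hFc hFs _)
    (fun δ => summable_integral_norm_chi_mul_innerInt_rational W R hR hc hu hc' hu' compT compT' F hFc hFs γ₀ δ)
    (fun t => integrable_conj_chi'_mul_Finf W R hc' hu' νinf' Finf hFinfc (γ₀ : GA W) t)
    (fun t => integrable_conj_chi'_mul_Ffin W R hc' hu' νf' Ffin hFfinc Cf hCf hFsupp (γ₀ : GA W) t)
    (integrable_chi_mul_innerInf W R hc hu hc' hu' νinf νinf' Finf hFinfc (γ₀ : GA W))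
    (integrableOn_chi_mul_innerFin W R hc hu hc' hu' νf νf' Ffin hFfinc Cf hCf hFsupp (γ₀ : GA W) hprop DZf hDZf hDZc)
    hreal hnonneg hpos
    (integrableOn_chi_conj_chi'_Ffin_prod W R hc hu hc' hu' νf νf' Ffin hFfinc Cf hCf hFsupp (γ₀ : GA W) hprop DZf
      hDZf hDZc)
    hsupp harch

end Composition2

end Summit.Ventures.HodgeRepro.Tier4.Line4

end
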